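import Literature.Geometry.Riemannian.HamiltonMaximumPrincipleSpatial
import HarnessLib

/-!
# Hamilton's maximum principle for the curvature ODE, in one chart: the two continuity steps

The analytic core of the proof of the named fact
`Literature.Geometry.Riemannian.hamilton_maximumPrinciple_curvatureODE` (`HamiltonCurvatureODE.lean`;
Hamilton 1986, §4, Thm. 4.3; Chow–Lu 2004, Thm. 3 for time-dependent sets), for a smooth family of
metric components `G` solving the Ricci flow in coordinates on `V × [0, t₁]` (a Ricci flow read in a
chart) and a compact `K ⊆ V`. The quantity controlled is the distance, in the Euclidean model
`Euc = ℝ^{27}` of block triples, of the block vector `bvec r = toEuc (blocks r)` of the curvature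
components `r = rmComp (G s) y W` on `G(s,y)`-orthonormal `4`-frames `W` from the model
`Z' s` of the convex set `Z s` (Hamilton 1986, §4, p. 160: "the distance `s(M)` from `M` to `X`").

* `HamiltonMP.bvecCLM` — `r ↦ toEuc (blocks r)` as a continuous linear map, and
  `bvecCLM_reaction`: `bvec (reaction r) = fieldEuc (bvec r)` for algebraic curvature arrays
  (`CurvComp.IsAlgCurv.blocks_reaction`) — the Uhlenbeck-frame evolution of `bvec` is
  `ΔRm`-part `+` Hamilton's field.
* `HamiltonMP.isCompact_frameSet` — the set of `(y, s, W)`, `y ∈ K`, `s ∈ [0, t₁]`, `W` orthonormal for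
  `G(s, y)`, is compact; `HamiltonMP.hasDerivWithinAt_bvec_frame` — along an Uhlenbeck frame,
  `d/dσ bvec = bvec(ΔRm-array) + fieldEuc(bvec)` (`dRmForm_uhlenbeck_eq`).
* **`HamiltonMP.piece_right_step`** — the right Dini estimate (Hamilton 1986, §4, proof of
  Thm. 4.3 / Chow–Lu 2004, proof of Thm. 3, in the tree's arrangement): if at time `t₀` every
  orthonormal frame over `V` has `dist(bvec, Z' t₀) ≤ B(t₀)`, `B(t) = ε e^{(Lip+1)t}`, then for
  `s ∈ (t₀, t₀ + δ]` every orthonormal frame over `K` has `dist(bvec, Z' s) ≤ B(s)` and `Z' s ≠ ∅`: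
  backward Uhlenbeck frame, the spatial estimate (`spatial_estimate`), the nearest point of `Z' t₀`,
  the ODE solution of `fieldEuc` from it (which stays in `Z'` by ODE-invariance), Lipschitz
  comparison.
* **`HamiltonMP.piece_left_step`** — closedness from the left: bounds `dist ≤ B(s)` for `s < t*`
  along a backward Uhlenbeck frame pass to `t*` by the closedness of the space-time track of `Z'`
  and compactness of bounded sets of `Euc`.

Everything is proved; no definition of `Prop` type is introduced.

## References

* R. S. Hamilton, *Four-manifolds with positive curvature operator*, J. Differential Geom. 24
  (1986) 153–179, §3 (Lipschitz calculus), §4 (Lemma 4.1, Thm. 4.2, Thm. 4.3). [Hamilton1986]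
* B. Chow, P. Lu, *The time-dependent maximum principle for systems of parabolic equations subject
  to an avoidance set*, Pacific J. Math. 214 (2004) 201–222, §2, Thm. 3. [ChowLu2004]
-/

noncomputable section

set_option maxSynthPendingDepth 3

open Set Filter Metric ContinuousLinearMap Module
open scoped Topology ContDiff NNReal

namespace Literature.Geometry.Riemannian

namespace HamiltonMP

open Lorentzian Lorentzian.MetricCoord CurvComp HamiltonODE

/-! ### The block vector of a component array -/

/-- The **block vector** of a component array: Hamilton's blocks `(A, B, C)` read in the Euclidean
model `ℝ^{27}`, `r ↦ toEuc (blocks r)`, a continuous linear map. [cite: Hamilton1986, §4, p. 160] -/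
def bvecCLM : Comp →L[ℝ] Euc :=
  LinearMap.toContinuousLinearMap
    { toFun := fun r ↦ toEuc (blocks r)
      map_add' := fun r r' ↦ by
        rw [← map_add]; congr 1
        ext i j <;> simp [blocks, CurvComp.blockA, CurvComp.blockB, CurvComp.blockC, pairing,
          Finset.sum_add_distrib]
      map_smul' := fun c r ↦ by
        rw [RingHom.id_apply, ← map_smul]; congr 1
        ext i j <;> simp [blocks, CurvComp.blockA, CurvComp.blockB, CurvComp.blockC, pairing] <;> ring }

/-- `bvecCLM r = toEuc (blocks r)`. [folklore] -/
@[simp] theorem bvecCLM_apply (r : Comp) : bvecCLM r = toEuc (blocks r) := rfl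

/-- **The reaction term read in the model is Hamilton's field**: for an algebraic curvature array,
`bvec (reaction r) = fieldEuc (bvec r)` (`CurvComp.IsAlgCurv.blocks_reaction`).
[cite: Hamilton1986, §6, p. 166] -/
theorem bvecCLM_reaction {r : Comp} (h : IsAlgCurv r) : bvecCLM (reaction r) = fieldEuc (bvecCLM r) := by
  rw [bvecCLM_apply, bvecCLM_apply, h.blocks_reaction, fieldEuc, ofEuc_toEuc]

/-! ### The frame set of a family over a compact set and the quantities on it -/

section Family

variable {E : Type*} [NormedAddCommGroup E] [NormedSpace ℝ E] [FiniteDimensional ℝ E] [CompleteSpace E]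
  {G : ℝ → E → E →L[ℝ] E →L[ℝ] ℝ} {V K : Set E} {t₁ : ℝ}

/-- The **frame set** of a family over `K` on `[0, t₁]`: triples `(y, s, W)` with `y ∈ K`,
`s ∈ [0, t₁]` and `W` a `G(s, y)`-orthonormal `4`-frame. [cite: Hamilton1986, §4, p. 163] -/
def frameSet (G : ℝ → E → E →L[ℝ] E →L[ℝ] ℝ) (K : Set E) (t₁ : ℝ) : Set (E × ℝ × (Fin 4 → E)) :=
  {p | p.1 ∈ K ∧ p.2.1 ∈ Icc 0 t₁ ∧ IsONFrame (G p.2.1 p.1) p.2.2}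

/-- The time derivative of the components along an Uhlenbeck frame, as a function of the state
`(y, s, W)`: `∂_t Rm(W,W,W,W) + Rm(Ric^♯W, W, W, W) + … + Rm(W, W, W, Ric^♯W)`
(`hasDerivWithinAt_rmComp_frame` with `W' = Ric^♯ W`). [cite: Hamilton1986, §2, p. 157] -/
def dArr (G : ℝ → E → E →L[ℝ] E →L[ℝ] ℝ) (t₁ : ℝ) (p : E × ℝ × (Fin 4 → E)) : Comp := fun a b c d ↦
  dRmForm G (Icc 0 t₁) p.2.1 p.1 (p.2.2 a) (p.2.2 b) (p.2.2 c) (p.2.2 d)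
    + rmForm (G p.2.1) p.1 (ricOp (G p.2.1) p.1 (p.2.2 a)) (p.2.2 b) (p.2.2 c) (p.2.2 d)
    + rmForm (G p.2.1) p.1 (p.2.2 a) (ricOp (G p.2.1) p.1 (p.2.2 b)) (p.2.2 c) (p.2.2 d)
    + rmForm (G p.2.1) p.1 (p.2.2 a) (p.2.2 b) (ricOp (G p.2.1) p.1 (p.2.2 c)) (p.2.2 d)
    + rmForm (G p.2.1) p.1 (p.2.2 a) (p.2.2 b) (p.2.2 c) (ricOp (G p.2.1) p.1 (p.2.2 d))

/-- The components on the frame, as a function of the state `(y, s, W)`. [folklore] -/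
def rArr (G : ℝ → E → E →L[ℝ] E →L[ℝ] ℝ) (p : E × ℝ × (Fin 4 → E)) : Comp := rmComp (G p.2.1) p.1 p.2.2

omit [CompleteSpace E] [FiniteDimensional ℝ E] in
/-- Unfolding `rArr`. [folklore] -/
theorem rArr_apply (p : E × ℝ × (Fin 4 → E)) : rArr G p = rmComp (G p.2.1) p.1 p.2.2 := rfl

/-- `rArr` is continuous on `{(y, s, W) : y ∈ V, s ∈ [0, t₁]}`. [cite: Topping2006, §1.2.3] -/
theorem continuousOn_rArr (hG : IsMetricFamilyOn G (Icc 0 t₁) V) :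
    ContinuousOn (rArr G) {p : E × ℝ × (Fin 4 → E) | p.1 ∈ V ∧ p.2.1 ∈ Icc 0 t₁} := by
  have h6 := hG.continuousOn_rmForm_family₆
  refine continuousOn_pi.2 fun a ↦ continuousOn_pi.2 fun b ↦ continuousOn_pi.2 fun c ↦
    continuousOn_pi.2 fun d ↦ ?_
  have hmap : Continuous fun p : E × ℝ × (Fin 4 → E) ↦
      ((p.1, p.2.1), p.2.2 a, p.2.2 b, p.2.2 c, p.2.2 d) := by fun_prop
  exact h6.comp hmap.continuousOn fun p hp ↦ ⟨⟨hp.1, hp.2⟩, mem_univ _⟩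

/-- `dArr` is continuous on `{(y, s, W) : y ∈ V, s ∈ [0, t₁]}`. [cite: Topping2006, §1.2.3] -/
theorem continuousOn_dArr (hG : IsMetricFamilyOn G (Icc 0 t₁) V) :
    ContinuousOn (dArr G t₁) {p : E × ℝ × (Fin 4 → E) | p.1 ∈ V ∧ p.2.1 ∈ Icc 0 t₁} := by
  set T₀ : Set (E × ℝ × (Fin 4 → E)) := {p | p.1 ∈ V ∧ p.2.1 ∈ Icc 0 t₁} with hT₀
  have h6 := hG.continuousOn_rmForm_family₆
  have hd6 := hG.continuousOn_dRmForm_family₆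
  have hyt : Continuous fun p : E × ℝ × (Fin 4 → E) ↦ (p.1, p.2.1) := by fun_prop
  have hmem : ∀ p ∈ T₀, (p.1, p.2.1) ∈ V ×ˢ Icc 0 t₁ := fun p hp ↦ ⟨hp.1, hp.2⟩
  have hric : ContinuousOn (fun p : E × ℝ × (Fin 4 → E) ↦ ricOp (G p.2.1) p.1) T₀ :=
    hG.contDiffOn_ricOp_family.continuousOn.comp hyt.continuousOn hmem
  have hW : ∀ i, ContinuousOn (fun p : E × ℝ × (Fin 4 → E) ↦ p.2.2 i) T₀ := fun i ↦
    (by fun_prop : Continuous fun p : E × ℝ × (Fin 4 → E) ↦ p.2.2 i).continuousOn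
  have hrW : ∀ i, ContinuousOn (fun p : E × ℝ × (Fin 4 → E) ↦ ricOp (G p.2.1) p.1 (p.2.2 i)) T₀ := fun i ↦
    hric.clm_apply (hW i)
  -- terms of the shape `Rm(X, Y, Z, U)` and `∂_t Rm(X, Y, Z, U)` with continuous arguments
  have T : ∀ {X Y Z U : E × ℝ × (Fin 4 → E) → E}, ContinuousOn X T₀ → ContinuousOn Y T₀ →
      ContinuousOn Z T₀ → ContinuousOn U T₀ →
      ContinuousOn (fun p : E × ℝ × (Fin 4 → E) ↦ rmForm (G p.2.1) p.1 (X p) (Y p) (Z p) (U p)) T₀ := by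
    intro X Y Z U hX hY hZ hU
    exact h6.comp (hyt.continuousOn.prodMk (hX.prodMk (hY.prodMk (hZ.prodMk hU))))
      fun p hp ↦ ⟨hmem p hp, mem_univ _⟩
  have T0 : ∀ {X Y Z U : E × ℝ × (Fin 4 → E) → E}, ContinuousOn X T₀ → ContinuousOn Y T₀ →
      ContinuousOn Z T₀ → ContinuousOn U T₀ →
      ContinuousOn (fun p : E × ℝ × (Fin 4 → E) ↦ dRmForm G (Icc 0 t₁) p.2.1 p.1 (X p) (Y p) (Z p) (U p)) T₀ := by
    intro X Y Z U hX hY hZ hU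
    exact hd6.comp (hyt.continuousOn.prodMk (hX.prodMk (hY.prodMk (hZ.prodMk hU))))
      fun p hp ↦ ⟨hmem p hp, mem_univ _⟩
  refine continuousOn_pi.2 fun a ↦ continuousOn_pi.2 fun b ↦ continuousOn_pi.2 fun c ↦
    continuousOn_pi.2 fun d ↦ ?_
  change ContinuousOn (fun p : E × ℝ × (Fin 4 → E) ↦ dArr G t₁ p a b c d) T₀
  unfold dArr
  exact ((((T0 (hW a) (hW b) (hW c) (hW d)).add (T (hrW a) (hW b) (hW c) (hW d))).add
    (T (hW a) (hrW b) (hW c) (hW d))).add (T (hW a) (hW b) (hrW c) (hW d))).add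
    (T (hW a) (hW b) (hW c) (hrW d))

omit [CompleteSpace E] in
/-- **The frame set is compact** (closed by continuity of `(y, s) ↦ G(s, y)`; bounded by the
uniform positive-definiteness over the compact `K × [0, t₁]`). [cite: Hamilton1986, §4, p. 163] -/
theorem isCompact_frameSet (hG : IsMetricFamilyOn G (Icc 0 t₁) V)
    (hpos : ∀ s ∈ Icc 0 t₁, ∀ y ∈ V, ∀ v : E, v ≠ 0 → 0 < G s y v v) (hK : IsCompact K) (hKV : K ⊆ V) :
    IsCompact (frameSet G K t₁) ∧
      ∃ R ≥ 0, ∀ p ∈ frameSet G K t₁, ‖p.2.2‖ ≤ R ∧ ∀ i, ‖p.2.2 i‖ ≤ R := by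
  -- uniform positivity over `K × [0, t₁]`
  have hGc : ContinuousOn (fun q : E × ℝ ↦ G q.2 q.1) (K ×ˢ Icc 0 t₁) :=
    hG.contDiffOn.continuousOn.mono (prod_mono hKV Subset.rfl)
  obtain ⟨lam, hlam, hlamK⟩ := exists_pos_le_quadratic_of_isCompact (hK.prod isCompact_Icc) hGc
    fun q hq v hv ↦ hpos q.2 hq.2 q.1 (hKV hq.1) v hv
  set R : ℝ := (Real.sqrt lam)⁻¹ with hR
  have hR0 : 0 ≤ R := by positivity
  have hbound : ∀ p ∈ frameSet G K t₁, ‖p.2.2‖ ≤ R ∧ ∀ i, ‖p.2.2 i‖ ≤ R := by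
    rintro ⟨y, s, W⟩ ⟨hy, hs, hW⟩
    have hi : ∀ i, ‖W i‖ ≤ R := fun i ↦ hW.norm_le hlam (hlamK (y, s) ⟨hy, hs⟩) i
    exact ⟨(pi_norm_le_iff_of_nonneg hR0).2 hi, hi⟩
  refine ⟨?_, R, hR0, hbound⟩
  -- closedness
  have hA : IsClosed (K ×ˢ ((Icc (0 : ℝ) t₁) ×ˢ (univ : Set (Fin 4 → E)))) :=
    hK.isClosed.prod (isClosed_Icc.prod isClosed_univ)
  have hf : ContinuousOn (fun p : E × ℝ × (Fin 4 → E) ↦ fun i j : Fin 4 ↦ G p.2.1 p.1 (p.2.2 i) (p.2.2 j))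
      (K ×ˢ ((Icc (0 : ℝ) t₁) ×ˢ (univ : Set (Fin 4 → E)))) := by
    have hGp : ContinuousOn (fun p : E × ℝ × (Fin 4 → E) ↦ G p.2.1 p.1)
        (K ×ˢ ((Icc (0 : ℝ) t₁) ×ˢ (univ : Set (Fin 4 → E)))) :=
      hGc.comp (by fun_prop : Continuous fun p : E × ℝ × (Fin 4 → E) ↦ (p.1, p.2.1)).continuousOn
        fun p hp ↦ ⟨hp.1, hp.2.1⟩
    refine continuousOn_pi.2 fun i ↦ continuousOn_pi.2 fun j ↦ ?_
    exact (hGp.clm_apply (by fun_prop : Continuous fun p : E × ℝ × (Fin 4 → E) ↦ p.2.2 i).continuousOn).clm_apply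
      (by fun_prop : Continuous fun p : E × ℝ × (Fin 4 → E) ↦ p.2.2 j).continuousOn
  have heq : frameSet G K t₁ = (K ×ˢ ((Icc (0 : ℝ) t₁) ×ˢ (univ : Set (Fin 4 → E)))) ∩
      (fun p : E × ℝ × (Fin 4 → E) ↦ fun i j : Fin 4 ↦ G p.2.1 p.1 (p.2.2 i) (p.2.2 j)) ⁻¹'
        {fun i j : Fin 4 ↦ if i = j then (1 : ℝ) else 0} := by
    ext ⟨y, s, W⟩
    simp only [frameSet, mem_setOf_eq, mem_inter_iff, mem_prod, mem_univ, and_true, mem_preimage,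
      mem_singleton_iff, IsONFrame]
    constructor
    · rintro ⟨hy, hs, hW⟩; exact ⟨⟨hy, hs⟩, funext fun i ↦ funext fun j ↦ hW i j⟩
    · rintro ⟨⟨hy, hs⟩, hW⟩; exact ⟨hy, hs, fun i j ↦ by have := congrFun (congrFun hW i) j; exact this⟩
  have hclosed : IsClosed (frameSet G K t₁) := by
    rw [heq]; exact hf.preimage_isClosed_of_isClosed hA isClosed_singleton
  -- boundedness
  have hbdd : Bornology.IsBounded (frameSet G K t₁) := by
    have hsub : frameSet G K t₁ ⊆ K ×ˢ ((Icc (0 : ℝ) t₁) ×ˢ closedBall (0 : Fin 4 → E) R) := by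
      rintro ⟨y, s, W⟩ hp
      exact ⟨hp.1, hp.2.1, mem_closedBall_zero_iff.2 (hbound _ hp).1⟩
    exact (hK.isBounded.prod (isCompact_Icc.isBounded.prod isBounded_closedBall)).subset hsub
  exact isCompact_of_isClosed_isBounded hclosed hbdd

/-- **The derivative of the block vector along an Uhlenbeck frame**: if `W` solves `W' = Ric^♯ W`
within `[a, b] ⊆ [0, t₁]` at `σ` and `W(σ)` is `G(σ, y)`-orthonormal, then
`d/dσ bvec(rmComp (G σ) y (W σ)) = bvec(lapComp (G σ) y (W σ)) + fieldEuc(bvec(…))` within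
`[a, b]` (Leibniz rule, `dRmForm_uhlenbeck_eq`, `bvecCLM_reaction`) — Hamilton's
`∂M/∂t = ΔM + M² + M^#` read on the frame. [cite: Hamilton1986, §2, p. 157] -/
theorem hasDerivWithinAt_bvec_frame (hG : IsMetricFamilyOn G (Icc 0 t₁) V)
    (hfl : ∀ s ∈ Icc 0 t₁, ∀ y ∈ V, tDeriv G (Icc 0 t₁) s y = (-2 : ℝ) • ricAt (G s) y)
    (h4 : finrank ℝ E = 4) {y : E} (hy : y ∈ V) {a b σ : ℝ} (hsub : Icc a b ⊆ Icc 0 t₁) (hσ : σ ∈ Icc a b)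
    {W : ℝ → Fin 4 → E} (hW : HasDerivWithinAt W (fun i ↦ ricOp (G σ) y (W σ i)) (Icc a b) σ)
    (hON : IsONFrame (G σ y) (W σ)) :
    HasDerivWithinAt (fun τ ↦ bvecCLM (rmComp (G τ) y (W τ)))
      (bvecCLM (lapComp (G σ) y (W σ)) + fieldEuc (bvecCLM (rmComp (G σ) y (W σ)))) (Icc a b) σ ∧
    HasDerivWithinAt (fun τ ↦ bvecCLM (rmComp (G τ) y (W τ))) (bvecCLM (dArr G t₁ (y, σ, W σ))) (Icc a b) σ := by
  have hσS : σ ∈ Icc 0 t₁ := hsub hσ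
  have hr : HasDerivWithinAt (fun τ ↦ rmComp (G τ) y (W τ)) (dArr G t₁ (y, σ, W σ)) (Icc a b) σ :=
    hasDerivWithinAt_pi.2 fun i ↦ hasDerivWithinAt_pi.2 fun j ↦ hasDerivWithinAt_pi.2 fun k ↦
      hasDerivWithinAt_pi.2 fun l ↦ hG.hasDerivWithinAt_rmComp_frame hy hsub hσ hW i j k l
  have hb : HasDerivWithinAt (fun τ ↦ bvecCLM (rmComp (G τ) y (W τ))) (bvecCLM (dArr G t₁ (y, σ, W σ)))
      (Icc a b) σ := bvecCLM.hasFDerivAt.comp_hasDerivWithinAt σ hr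
  refine ⟨hb.congr_deriv ?_, hb⟩
  have hd : dArr G t₁ (y, σ, W σ) = lapComp (G σ) y (W σ) + reaction (rmComp (G σ) y (W σ)) := by
    funext i j k l
    exact dRmForm_uhlenbeck_eq hG hfl hy hσS hON h4 i j k l
  rw [hd, map_add, bvecCLM_reaction (isAlgCurv_rmComp (hG.isMetricOn σ hσS) hy (W σ))]

/-! ### Closedness from the left -/

/-- **Left step** (closedness of the estimate under limits from the left; Hamilton 1986, §3,
Lemma 3.1 / Chow–Lu 2004, proof of Thm. 3, the role of the closed space-time track). If for all
earlier times `s < t*` the block vectors of the orthonormal frames at `y` are within `B(s)` of the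
nonempty `Z' s`, then — following an Uhlenbeck frame backwards from the frame `W₀` at `t*` and
passing to the limit through the closed space-time track of `Z'` and the compactness of bounded
sets — the same holds at `t*`, and `Z' t* ≠ ∅`. [cite: ChowLu2004, §2, Thm. 3] -/
theorem piece_left_step (hG : IsMetricFamilyOn G (Icc 0 t₁) V)
    (hfl : ∀ s ∈ Icc 0 t₁, ∀ y ∈ V, tDeriv G (Icc 0 t₁) s y = (-2 : ℝ) • ricAt (G s) y)
    (h4 : finrank ℝ E = 4) {Z' : ℝ → Set Euc} (htrack : IsClosed {q : ℝ × Euc | 0 ≤ q.1 ∧ q.2 ∈ Z' q.1})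
    {B : ℝ → ℝ} (hB : Continuous B) {tstar : ℝ} (hts : tstar ∈ Ioc 0 t₁) {y : E} (hy : y ∈ V)
    {W₀ : Fin 4 → E} (hW₀ : IsONFrame (G tstar y) W₀)
    (hbefore : ∀ s ∈ Ico 0 tstar, (Z' s).Nonempty ∧ ∀ W : Fin 4 → E, IsONFrame (G s y) W →
      infDist (bvecCLM (rmComp (G s) y W)) (Z' s) ≤ B s) :
    infDist (bvecCLM (rmComp (G tstar) y W₀)) (Z' tstar) ≤ B tstar ∧ (Z' tstar).Nonempty := by
  have htsS : tstar ∈ Icc 0 t₁ := ⟨hts.1.le, hts.2⟩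
  -- a bound for `Ric^♯` at `y` over `[0, t₁]`
  obtain ⟨N₀, hN₀⟩ := isCompact_Icc.exists_bound_of_continuousOn (hG.continuousOn_ricOp hy)
  set N : ℝ := |N₀| + 1 with hN
  have hNpos : 0 < N := by positivity
  have hNb : ∀ σ ∈ Icc 0 t₁, ‖ricOp (G σ) y‖ ≤ N := fun σ hσ ↦
    (hN₀ σ hσ).trans ((le_abs_self _).trans (by linarith))
  -- the backward interval `[a, t*]`
  set a : ℝ := max 0 (tstar - 1 / (2 * N)) with ha
  have ha0 : 0 ≤ a := le_max_left _ _
  have hat : a < tstar := by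
    have : 0 < 1 / (2 * N) := by positivity
    exact max_lt hts.1 (by linarith)
  have hsub : Icc a tstar ⊆ Icc 0 t₁ := Icc_subset_Icc ha0 hts.2
  have hlen : N * (tstar - a) ≤ 1 / 2 := by
    have h1 : tstar - a ≤ 1 / (2 * N) := by have := le_max_right 0 (tstar - 1 / (2 * N)); linarith
    calc N * (tstar - a) ≤ N * (1 / (2 * N)) := by gcongr
      _ = 1 / 2 := by field_simp
  -- the backward Uhlenbeck frame
  obtain ⟨Wf, hWf0, hWfd, -⟩ := hG.exists_frameODE hy hNpos.le hNb hsub hlen (right_mem_Icc.2 hat.le) W₀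
  have hON : ∀ σ ∈ Icc a tstar, IsONFrame (G σ y) (Wf σ) :=
    hG.isONFrame_frameODE hfl hy hsub hWfd (right_mem_Icc.2 hat.le) (hWf0 ▸ hW₀)
  -- the block vector along it and its continuity
  set b : ℝ → Euc := fun σ ↦ bvecCLM (rmComp (G σ) y (Wf σ)) with hb
  have hbc : ContinuousOn b (Icc a tstar) := fun σ hσ ↦
    ((hasDerivWithinAt_bvec_frame hG hfl h4 hy hsub hσ (hWfd σ hσ) (hON σ hσ)).2).continuousWithinAt
  obtain ⟨Cb, hCb⟩ := isCompact_Icc.exists_bound_of_continuousOn hbc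
  obtain ⟨CB, hCB⟩ := isCompact_Icc.exists_bound_of_continuousOn (hB.continuousOn (s := Icc a tstar))
  -- the sequence of times
  set sq : ℕ → ℝ := fun n ↦ tstar - (tstar - a) / ((n : ℝ) + 2) with hsq
  have hsq_mem : ∀ n, sq n ∈ Ico a tstar := by
    intro n
    have hn : (2 : ℝ) ≤ (n : ℝ) + 2 := by have := Nat.cast_nonneg (α := ℝ) n; linarith
    have hpos' : 0 < (n : ℝ) + 2 := by linarith
    constructor
    · have : (tstar - a) / ((n : ℝ) + 2) ≤ tstar - a := div_le_self (by linarith) (by linarith)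
      simp only [hsq]; linarith
    · have : 0 < (tstar - a) / ((n : ℝ) + 2) := div_pos (by linarith) hpos'
      simp only [hsq]; linarith
  have hsq_tend : Tendsto sq atTop (𝓝 tstar) := by
    have h1 : Tendsto (fun n : ℕ ↦ (tstar - a) / ((n : ℝ) + 2)) atTop (𝓝 0) := by
      have := tendsto_const_div_atTop_nhds_zero_nat (tstar - a)
      refine Tendsto.congr' ?_ ((tendsto_const_div_atTop_nhds_zero_nat (tstar - a)).comp (tendsto_add_atTop_nat 2))
      filter_upwards with n
      simp [Nat.cast_add]
    have := tendsto_const_nhds (x := tstar).sub h1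
    simpa [hsq] using this
  -- points of `Z'` near `b (sq n)`
  have hex : ∀ n, ∃ z ∈ Z' (sq n), dist (b (sq n)) z < B (sq n) + 1 / ((n : ℝ) + 1) := by
    intro n
    obtain ⟨hne, hbd⟩ := hbefore (sq n) ⟨ha0.trans (hsq_mem n).1, (hsq_mem n).2⟩
    have hle := hbd (Wf (sq n)) (hON (sq n) (Ico_subset_Icc_self (hsq_mem n)))
    exact (infDist_lt_iff hne).1 (lt_of_le_of_lt hle (lt_add_of_pos_right _ (by positivity)))
  choose z hz hdz using hex
  -- the `z n` are bounded, hence have a convergent subsequence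
  have hzb : ∀ n, z n ∈ closedBall (0 : Euc) (Cb + CB + 1) := by
    intro n
    have hmem : sq n ∈ Icc a tstar := Ico_subset_Icc_self (hsq_mem n)
    rw [mem_closedBall, dist_zero_right]
    have h1 : ‖z n‖ ≤ ‖b (sq n)‖ + dist (b (sq n)) (z n) := by
      rw [dist_eq_norm, ← norm_neg (b (sq n) - z n), neg_sub]; exact norm_le_insert' _ _
    have h2 : 1 / ((n : ℝ) + 1) ≤ 1 := by
      rw [div_le_one (by positivity)]; have := Nat.cast_nonneg (α := ℝ) n; linarith
    have h3 := hCb (sq n) hmem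
    have h4' := (Real.le_norm_self _).trans (hCB (sq n) hmem)
    linarith [hdz n]
  obtain ⟨zs, -, φ, hφ, hzφ⟩ := tendsto_subseq_of_bounded isBounded_closedBall hzb
  -- the limit point lies in `Z' t*` (closed space-time track)
  have hpair : Tendsto (fun n ↦ (sq (φ n), z (φ n))) atTop (𝓝 (tstar, zs)) :=
    (hsq_tend.comp hφ.tendsto_atTop).prodMk_nhds hzφ
  have hzs : zs ∈ Z' tstar := by
    have hmem := htrack.mem_of_tendsto hpair (Eventually.of_forall fun n ↦
      ⟨ha0.trans (hsq_mem (φ n)).1, hz (φ n)⟩)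
    exact hmem.2
  refine ⟨?_, ⟨zs, hzs⟩⟩
  -- pass to the limit in `dist (b (sq n)) (z n) < B (sq n) + 1/(n+1)`
  have hbt : Tendsto (fun n ↦ b (sq (φ n))) atTop (𝓝 (b tstar)) := by
    have hcw := hbc tstar (right_mem_Icc.2 hat.le)
    refine hcw.tendsto.comp (tendsto_nhdsWithin_iff.2 ⟨hsq_tend.comp hφ.tendsto_atTop, ?_⟩)
    exact Eventually.of_forall fun n ↦ Ico_subset_Icc_self (hsq_mem (φ n))
  have hlim1 : Tendsto (fun n ↦ dist (b (sq (φ n))) (z (φ n))) atTop (𝓝 (dist (b tstar) zs)) :=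
    hbt.dist hzφ
  have hlim2 : Tendsto (fun n ↦ B (sq (φ n)) + 1 / (((φ n : ℕ) : ℝ) + 1)) atTop (𝓝 (B tstar + 0)) := by
    refine ((hB.tendsto tstar).comp (hsq_tend.comp hφ.tendsto_atTop)).add ?_
    exact tendsto_one_div_add_atTop_nhds_zero_nat.comp hφ.tendsto_atTop
  rw [add_zero] at hlim2
  have hle : dist (b tstar) zs ≤ B tstar :=
    le_of_tendsto_of_tendsto' hlim1 hlim2 fun n ↦ (hdz (φ n)).le
  calc infDist (bvecCLM (rmComp (G tstar) y W₀)) (Z' tstar) = infDist (b tstar) (Z' tstar) := by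
        simp only [hb, hWf0]
    _ ≤ dist (b tstar) zs := infDist_le_dist_of_mem hzs
    _ ≤ B tstar := hle

/-! ### The right Dini step -/

set_option maxHeartbeats 1600000 in
/-- **Right step** (Hamilton 1986, §4, proof of Thm. 4.3; Chow–Lu 2004, proof of Thm. 3 — the
estimate `D⁺ dist ≤ Lip · dist` in the tree's arrangement, uniformly over the orthonormal frames
over the compact `K`). Along a smooth family solving the Ricci flow in coordinates on
`V × [0, t₁]` in dimension `4`, let `Z' s ⊆ ℝ^{27}` be convex closed sets which ODE-solutions of
Hamilton's field `fieldEuc` cannot leave, let `Rc` bound the block vectors of the frames of the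
frame set, `Lip`/`MF` a Lipschitz constant / bound of the field on the ball of radius `Rc + 4`, and
`B(t) = ε e^{(Lip+1)t} ≤ 1` on `[0, t₁]`. If at `t₀` every orthonormal frame over `V` has its block
vector within `B(t₀)` of the nonempty `Z' t₀`, then for some `δ > 0` and all `s ∈ (t₀, t₀ + δ]`,
`s ≤ t₁`, every orthonormal frame over `K` at time `s` has its block vector within `B(s)` of
`Z' s`, which is nonempty. Ingredients: a backward Uhlenbeck frame from the given frame
(`exists_frameODE`, `isONFrame_frameODE`), the derivative `ΔRm`-part `+ fieldEuc`
(`hasDerivWithinAt_bvec_frame`) with its uniform modulus on the compact frame set, the spatial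
estimate at `t₀` (`spatial_estimate`), the nearest point `z ∈ Z' t₀`, the solution of
`β' = fieldEuc β` from `z` (Picard–Lindelöf, confined), which lies in `Z' s` at time `s`, and the
Lipschitz comparison of the two curves. [cite: Hamilton1986, §4, Thm. 4.3] [cite: ChowLu2004, §2, Thm. 3] -/
theorem piece_right_step (hG : IsMetricFamilyOn G (Icc 0 t₁) V)
    (hfl : ∀ s ∈ Icc 0 t₁, ∀ y ∈ V, tDeriv G (Icc 0 t₁) s y = (-2 : ℝ) • ricAt (G s) y)
    (hpos : ∀ s ∈ Icc 0 t₁, ∀ y ∈ V, ∀ v : E, v ≠ 0 → 0 < G s y v v) (h4 : finrank ℝ E = 4)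
    (hK : IsCompact K) (hKV : K ⊆ V)
    {Z' : ℝ → Set Euc} (hconv : ∀ s, Convex ℝ (Z' s)) (hcl : ∀ s, IsClosed (Z' s))
    (hinv : ∀ (β : ℝ → Euc) (a b : ℝ), 0 ≤ a → a ≤ b →
      (∀ σ ∈ Icc a b, HasDerivAt β (fieldEuc (β σ)) σ) → β a ∈ Z' a → β b ∈ Z' b)
    {Rc : ℝ} (hRc : ∀ p ∈ frameSet G K t₁, ‖bvecCLM (rArr G p)‖ ≤ Rc)
    {Lip : ℝ≥0} (hLip : LipschitzOnWith Lip fieldEuc (closedBall (0 : Euc) (Rc + 4)))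
    {MF : ℝ} (hMF0 : 0 ≤ MF) (hMF : ∀ v ∈ closedBall (0 : Euc) (Rc + 4), ‖fieldEuc v‖ ≤ MF)
    {ε : ℝ} (hε : 0 < ε) (hεsmall : ε * Real.exp (((Lip : ℝ) + 1) * t₁) ≤ 1)
    {t₀ : ℝ} (ht₀ : t₀ ∈ Ico 0 t₁)
    (hP0 : ∀ y' ∈ V, ∀ W' : Fin 4 → E, IsONFrame (G t₀ y') W' →
      infDist (bvecCLM (rmComp (G t₀) y' W')) (Z' t₀) ≤ ε * Real.exp (((Lip : ℝ) + 1) * t₀))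
    (hne : (Z' t₀).Nonempty) :
    ∃ δ > 0, ∀ s ∈ Ioc t₀ (t₀ + δ), s ≤ t₁ → ∀ y ∈ K, ∀ W : Fin 4 → E, IsONFrame (G s y) W →
      infDist (bvecCLM (rmComp (G s) y W)) (Z' s) ≤ ε * Real.exp (((Lip : ℝ) + 1) * s) ∧
        (Z' s).Nonempty := by
  have ht₀S : t₀ ∈ Icc 0 t₁ := ⟨ht₀.1, ht₀.2.le⟩
  set L₁ : ℝ := (Lip : ℝ) + 1 with hL₁
  have hLip0 : 0 ≤ (Lip : ℝ) := Lip.2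
  have hL₁pos : 0 < L₁ := by positivity
  -- the barrier at `t₀`
  set B₀ : ℝ := ε * Real.exp (L₁ * t₀) with hB₀
  have hB₀ε : ε ≤ B₀ := by
    have : 1 ≤ Real.exp (L₁ * t₀) := Real.one_le_exp (by nlinarith [ht₀.1])
    nlinarith
  have hB₀pos : 0 < B₀ := hε.trans_le hB₀ε
  have hB₀1 : B₀ ≤ 1 := by
    have : Real.exp (L₁ * t₀) ≤ Real.exp (L₁ * t₁) :=
      Real.exp_le_exp.2 (by nlinarith [ht₀.2.le])
    nlinarith [hε.le]
  have hε1 : ε ≤ 1 := hB₀ε.trans hB₀1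
  -- (c1) the frame set is compact, frames are bounded
  obtain ⟨hFS, Rfr, hRfr0, hfrb⟩ := isCompact_frameSet hG hpos hK hKV
  have hFSsub : frameSet G K t₁ ⊆ {p : E × ℝ × (Fin 4 → E) | p.1 ∈ V ∧ p.2.1 ∈ Icc 0 t₁} :=
    fun p hp ↦ ⟨hKV hp.1, hp.2.1⟩
  -- (c2) a bound for `Ric^♯` over `K × [0, t₁]`
  obtain ⟨N₀, hN₀⟩ := (hK.prod isCompact_Icc).exists_bound_of_continuousOn
    (hG.contDiffOn_ricOp_family.continuousOn.mono (prod_mono hKV Subset.rfl))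
  set N : ℝ := |N₀| + 1 with hN
  have hNpos : 0 < N := by positivity
  have hNb : ∀ y ∈ K, ∀ σ ∈ Icc 0 t₁, ‖ricOp (G σ) y‖ ≤ N := fun y hy σ hσ ↦
    (hN₀ (y, σ) ⟨hy, hσ⟩).trans ((le_abs_self _).trans (by linarith))
  set speedW : ℝ := N * (2 * Rfr + 1) with hspeedW
  have hspeedW0 : 0 ≤ speedW := by positivity
  -- (c3) uniform continuity of the derivative array on the frame set
  have hΨu : UniformContinuousOn (dArr G t₁) (frameSet G K t₁) :=
    hFS.uniformContinuousOn_of_continuous ((continuousOn_dArr hG).mono hFSsub)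
  set Φn : ℝ := ‖(bvecCLM : Comp →L[ℝ] Euc)‖ with hΦn
  have hΦn0 : 0 ≤ Φn := norm_nonneg _
  set ηΨ : ℝ := ε / (8 * (Φn + 1)) with hηΨ
  have hηΨpos : 0 < ηΨ := by positivity
  obtain ⟨δΨ, hδΨ, hδΨu⟩ := Metric.uniformContinuousOn_iff_le.1 hΨu ηΨ hηΨpos
  -- (c4) a bound for the Laplacian reading at time `t₀` over the frames over `K`
  have hGt₀ := hG.isMetricOn t₀ ht₀S
  set FS₀ : Set (E × (Fin 4 → E)) := (fun p : E × ℝ × (Fin 4 → E) ↦ (p.1, p.2.2)) ''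
    (frameSet G K t₁ ∩ {p | p.2.1 = t₀}) with hFS₀
  have hFS₀c : IsCompact FS₀ := by
    refine (hFS.inter_right (isClosed_eq (by fun_prop) continuous_const)).image (by fun_prop)
  have hlapc : ContinuousOn (fun q : E × (Fin 4 → E) ↦ bvecCLM (lapComp (G t₀) q.1 q.2)) FS₀ := by
    refine bvecCLM.continuous.comp_continuousOn ((continuousOn_lapComp hGt₀).mono ?_)
    rintro q ⟨p, ⟨hp, -⟩, rfl⟩; exact hKV hp.1
  obtain ⟨Λ₀, hΛ₀⟩ := hFS₀c.exists_bound_of_continuousOn hlapc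
  set Λ : ℝ := |Λ₀| + 1 with hΛ
  have hΛpos : 0 < Λ := by positivity
  have hΛb : ∀ y ∈ K, ∀ W : Fin 4 → E, IsONFrame (G t₀ y) W → ‖bvecCLM (lapComp (G t₀) y W)‖ ≤ Λ := by
    intro y hy W hW
    have hmem : (y, W) ∈ FS₀ := ⟨(y, t₀, W), ⟨⟨hy, ht₀S, hW⟩, rfl⟩, rfl⟩
    exact (hΛ₀ (y, W) hmem).trans ((le_abs_self _).trans (by linarith))
  -- (c5) the spatial estimate at `t₀`
  obtain ⟨h₀, hh₀, hspatial⟩ := spatial_estimate hGt₀ (hpos t₀ ht₀S) hK hKV (bvecCLM : Comp →L[ℝ] Euc)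
    (η := ε / 8) (by positivity)
  -- (c6) the existence time of the field's ODE
  set hF : ℝ := 1 / (MF + 1) with hhF
  have hhFpos : 0 < hF := by positivity
  -- the final `δ`
  set C₁ : ℝ := (Lip : ℝ) * (Λ + 1 + MF) + 1 with hC₁
  have hC₁pos : 0 < C₁ := by positivity
  set δ : ℝ := min (t₁ - t₀) (min (1 / (2 * N)) (min h₀ (min (δΨ / (speedW + 1)) (min (1 / Λ)
    (min (hF / 2) (min (ε / (8 * C₁)) 1)))))) with hδ
  have hδpos : 0 < δ := by
    simp only [hδ, lt_min_iff]
    refine ⟨by linarith [ht₀.2], by positivity, hh₀, by positivity, by positivity, by positivity, by positivity,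
      one_pos⟩
  have hδ1 : δ ≤ t₁ - t₀ := min_le_left _ _
  have hδ2 : δ ≤ 1 / (2 * N) := (min_le_right _ _).trans (min_le_left _ _)
  have hδ3 : δ ≤ h₀ := (min_le_right _ _).trans ((min_le_right _ _).trans (min_le_left _ _))
  have hδ4 : δ ≤ δΨ / (speedW + 1) :=
    (min_le_right _ _).trans ((min_le_right _ _).trans ((min_le_right _ _).trans (min_le_left _ _)))
  have hδ5 : δ ≤ 1 / Λ := (min_le_right _ _).trans ((min_le_right _ _).trans ((min_le_right _ _).trans
    ((min_le_right _ _).trans (min_le_left _ _))))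
  have hδ6 : δ ≤ hF / 2 := (min_le_right _ _).trans ((min_le_right _ _).trans ((min_le_right _ _).trans
    ((min_le_right _ _).trans ((min_le_right _ _).trans (min_le_left _ _)))))
  have hδ7 : δ ≤ ε / (8 * C₁) := (min_le_right _ _).trans ((min_le_right _ _).trans ((min_le_right _ _).trans
    ((min_le_right _ _).trans ((min_le_right _ _).trans ((min_le_right _ _).trans (min_le_left _ _))))))
  have hδ8 : δ ≤ 1 := (min_le_right _ _).trans ((min_le_right _ _).trans ((min_le_right _ _).trans
    ((min_le_right _ _).trans ((min_le_right _ _).trans ((min_le_right _ _).trans (min_le_right _ _))))))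
  refine ⟨δ, hδpos, fun s hs hs1 y hy W hW ↦ ?_⟩
  -- the time step `h = s - t₀`
  set h : ℝ := s - t₀ with hh
  have hhpos : 0 < h := by simp only [hh]; linarith [hs.1]
  have hhδ : h ≤ δ := by simp only [hh]; linarith [hs.2]
  have hsS : s ∈ Icc 0 t₁ := ⟨ht₀.1.trans hs.1.le, hs1⟩
  have hsub : Icc t₀ s ⊆ Icc 0 t₁ := Icc_subset_Icc ht₀.1 hs1
  have hst₀ : t₀ ≤ s := hs.1.le
  -- (m1) the backward Uhlenbeck frame
  have hlen : N * (s - t₀) ≤ 1 / 2 := by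
    calc N * (s - t₀) = N * h := by rw [hh]
      _ ≤ N * (1 / (2 * N)) := by gcongr; exact hhδ.trans hδ2
      _ = 1 / 2 := by field_simp
  obtain ⟨Wf, hWfs, hWfd, hWfb⟩ := hG.exists_frameODE (hKV hy) hNpos.le (hNb y hy) hsub hlen
    (right_mem_Icc.2 hst₀) W
  have hON : ∀ σ ∈ Icc t₀ s, IsONFrame (G σ y) (Wf σ) :=
    hG.isONFrame_frameODE hfl (hKV hy) hsub hWfd (right_mem_Icc.2 hst₀) (hWfs ▸ hW)
  have hFSmem : ∀ σ ∈ Icc t₀ s, (y, σ, Wf σ) ∈ frameSet G K t₁ := fun σ hσ ↦ ⟨hy, hsub hσ, hON σ hσ⟩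
  have hWn : ‖W‖ ≤ Rfr := (hfrb (y, s, W) ⟨hy, hsS, hW⟩).1
  have hWspeed : ∀ σ ∈ Icc t₀ s, ‖Wf σ - Wf t₀‖ ≤ speedW * h := by
    intro σ hσ
    have key := IsMetricFamilyOn.norm_frameODE_sub_le hNpos.le (hNb y hy) hsub hWfd hWfb
      (left_mem_Icc.2 hst₀) hσ hσ.1
    calc ‖Wf σ - Wf t₀‖ ≤ N * (2 * ‖W‖ + 1) * (σ - t₀) := key
      _ ≤ N * (2 * Rfr + 1) * h := by
          apply mul_le_mul _ (by rw [hh]; linarith [hσ.2]) (by linarith [hσ.1]) (by positivity)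
          gcongr
  -- (m2) the block vector along the frame and its derivative
  set b : ℝ → Euc := fun σ ↦ bvecCLM (rmComp (G σ) y (Wf σ)) with hb
  have hbd : ∀ σ ∈ Icc t₀ s, HasDerivWithinAt b (bvecCLM (dArr G t₁ (y, σ, Wf σ))) (Icc t₀ s) σ :=
    fun σ hσ ↦ (hasDerivWithinAt_bvec_frame hG hfl h4 (hKV hy) hsub hσ (hWfd σ hσ) (hON σ hσ)).2
  set lapv : Euc := bvecCLM (lapComp (G t₀) y (Wf t₀)) with hlapv
  set db₀ : Euc := bvecCLM (dArr G t₁ (y, t₀, Wf t₀)) with hdb₀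
  have hdb₀eq : db₀ = lapv + fieldEuc (b t₀) := by
    have h1 := (hasDerivWithinAt_bvec_frame hG hfl h4 (hKV hy) hsub (left_mem_Icc.2 hst₀)
      (hWfd t₀ (left_mem_Icc.2 hst₀)) (hON t₀ (left_mem_Icc.2 hst₀)))
    have hu : UniqueDiffWithinAt ℝ (Icc t₀ s) t₀ := uniqueDiffOn_Icc hs.1 t₀ (left_mem_Icc.2 hst₀)
    exact hu.eq_deriv _ h1.2 h1.1
  -- (m3) the first-order expansion of `b`
  have hmod : ∀ τ ∈ Icc t₀ s, ‖bvecCLM (dArr G t₁ (y, τ, Wf τ)) - db₀‖ ≤ Φn * ηΨ := by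
    intro τ hτ
    have hdist : dist (y, τ, Wf τ) (y, t₀, Wf t₀) ≤ δΨ := by
      rw [Prod.dist_eq, Prod.dist_eq, dist_self, Real.dist_eq, dist_eq_norm]
      have h1 : |τ - t₀| ≤ δΨ := by
        rw [abs_of_nonneg (by linarith [hτ.1])]
        have : h ≤ δΨ := by
          calc h ≤ δΨ / (speedW + 1) := hhδ.trans hδ4
            _ ≤ δΨ := div_le_self hδΨ.le (by linarith)
        rw [hh] at this; linarith [hτ.2]
      have h2 : ‖Wf τ - Wf t₀‖ ≤ δΨ := by
        calc ‖Wf τ - Wf t₀‖ ≤ speedW * h := hWspeed τ hτ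
          _ ≤ speedW * (δΨ / (speedW + 1)) := by gcongr; exact hhδ.trans hδ4
          _ ≤ (speedW + 1) * (δΨ / (speedW + 1)) := by gcongr; linarith
          _ = δΨ := by field_simp
      simp only [max_le_iff]
      exact ⟨le_trans (le_refl _) hδΨ.le, h1, h2⟩
    have hu := hδΨu (y, τ, Wf τ) (hFSmem τ hτ) (y, t₀, Wf t₀) (hFSmem t₀ (left_mem_Icc.2 hst₀)) hdist
    rw [dist_eq_norm] at hu
    calc ‖bvecCLM (dArr G t₁ (y, τ, Wf τ)) - db₀‖
        = ‖bvecCLM (dArr G t₁ (y, τ, Wf τ) - dArr G t₁ (y, t₀, Wf t₀))‖ := by rw [map_sub]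
      _ ≤ Φn * ‖dArr G t₁ (y, τ, Wf τ) - dArr G t₁ (y, t₀, Wf t₀)‖ := bvecCLM.le_opNorm _
      _ ≤ Φn * ηΨ := by gcongr
  have hTaylor : ‖b s - b t₀ - h • db₀‖ ≤ (Φn * ηΨ) * h := by
    have := norm_sub_sub_smul_le (f := fun τ _ ↦ bvecCLM (dArr G t₁ (y, τ, Wf τ))) (α := b)
      (tmin := t₀) (tmax := s) (v := db₀) (η := Φn * ηΨ) hbd le_rfl hst₀ le_rfl hmod
    simpa [hh] using this
  -- (m4) the spatial estimate at the frame `Wf t₀`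
  set q : Euc := b t₀ + h • lapv with hq
  have hspat : infDist q (Z' t₀) ≤ B₀ + h * (ε / 8) :=
    hspatial y hy (Wf t₀) (hON t₀ (left_mem_Icc.2 hst₀)) h ⟨hhpos, hhδ.trans hδ3⟩ (Z' t₀) (hconv t₀) B₀
      hB₀pos.le hP0
  -- (m5) the nearest point of `Z' t₀`
  obtain ⟨z, hz, hzd⟩ := (hcl t₀).exists_infDist_eq_dist hne q
  have hqz : ‖q - z‖ ≤ B₀ + h * (ε / 8) := by rw [← dist_eq_norm, ← hzd]; exact hspat
  have hqz2 : ‖q - z‖ ≤ 2 := by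
    have : h * (ε / 8) ≤ 1 := by nlinarith [hhδ.trans hδ8, hε1]
    linarith
  have hbt₀ : ‖b t₀‖ ≤ Rc := hRc (y, t₀, Wf t₀) (hFSmem t₀ (left_mem_Icc.2 hst₀))
  have hlapn : ‖lapv‖ ≤ Λ := hΛb y hy (Wf t₀) (hON t₀ (left_mem_Icc.2 hst₀))
  have hhΛ : h * Λ ≤ 1 := by
    calc h * Λ ≤ (1 / Λ) * Λ := by gcongr; exact hhδ.trans hδ5
      _ = 1 := by field_simp
  have hqb : ‖q - b t₀‖ ≤ h * Λ := by
    rw [hq, add_sub_cancel_left, norm_smul, Real.norm_of_nonneg hhpos.le]; gcongr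
  have hzn : ‖z‖ ≤ Rc + 3 := by
    have : ‖z‖ ≤ ‖b t₀‖ + ‖q - b t₀‖ + ‖z - q‖ := by
      calc ‖z‖ = ‖b t₀ + (q - b t₀) + (z - q)‖ := by congr 1; abel
        _ ≤ ‖b t₀ + (q - b t₀)‖ + ‖z - q‖ := norm_add_le _ _
        _ ≤ ‖b t₀‖ + ‖q - b t₀‖ + ‖z - q‖ := by gcongr; exact norm_add_le _ _
    rw [norm_sub_rev z q] at this
    linarith
  have hbz : ‖b t₀ - z‖ ≤ B₀ + h * Λ + h := by
    calc ‖b t₀ - z‖ = ‖(b t₀ - q) + (q - z)‖ := by congr 1; abel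
      _ ≤ ‖b t₀ - q‖ + ‖q - z‖ := norm_add_le _ _
      _ ≤ h * Λ + (B₀ + h * (ε / 8)) := by rw [norm_sub_rev]; exact add_le_add hqb hqz
      _ ≤ B₀ + h * Λ + h := by nlinarith only [hε1, hhpos.le]
  -- (m6) the solution of the field's ODE from `z`
  have hball : closedBall z 1 ⊆ closedBall (0 : Euc) (Rc + 4) := by
    intro v hv
    rw [mem_closedBall, dist_zero_right]
    rw [mem_closedBall, dist_eq_norm] at hv
    calc ‖v‖ = ‖(v - z) + z‖ := by rw [sub_add_cancel]
      _ ≤ ‖v - z‖ + ‖z‖ := norm_add_le _ _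
      _ ≤ 1 + (Rc + 3) := add_le_add hv hzn
      _ = Rc + 4 := by ring
  have ht₀I : t₀ ∈ Icc (t₀ - hF) (t₀ + hF) := ⟨by linarith, by linarith⟩
  have hPL : IsPicardLindelof (fun _ : ℝ ↦ fieldEuc) (⟨t₀, ht₀I⟩ : Icc (t₀ - hF) (t₀ + hF)) z
      (1 : ℝ≥0) 0 ⟨MF, hMF0⟩ Lip := by
    refine IsPicardLindelof.of_time_independent (fun v hv ↦ hMF v (hball hv)) (hLip.mono hball) ?_
    have hmax : max (t₀ + hF - t₀) (t₀ - (t₀ - hF)) = hF := by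
      rw [show t₀ + hF - t₀ = hF by ring, show t₀ - (t₀ - hF) = hF by ring, max_self]
    have hle : MF * hF ≤ 1 := by
      rw [hhF, mul_one_div, div_le_one (by positivity)]; linarith only []
    show MF * max (t₀ + hF - t₀) (t₀ - (t₀ - hF)) ≤ ((1 : ℝ≥0) : ℝ) - ((0 : ℝ≥0) : ℝ)
    rw [hmax, NNReal.coe_one, NNReal.coe_zero, sub_zero]
    exact hle
  obtain ⟨Pt, hPt0, hPtd, hPtb⟩ := exists_solution_mem_closedBall hPL (mem_closedBall_self le_rfl)
  have hsI : Icc t₀ s ⊆ Ioo (t₀ - hF) (t₀ + hF) := fun σ hσ ↦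
    ⟨by linarith [hσ.1], by linarith [hσ.2, hhδ.trans hδ6, hs.2]⟩
  have hPtd' : ∀ σ ∈ Icc t₀ s, HasDerivAt Pt (fieldEuc (Pt σ)) σ := fun σ hσ ↦
    (hPtd σ (Ioo_subset_Icc_self (hsI hσ))).hasDerivAt (Icc_mem_nhds (hsI hσ).1 (hsI hσ).2)
  have hPts : Pt s ∈ Z' s := hinv Pt t₀ s ht₀.1 hst₀ hPtd' (hPt0 ▸ hz)
  -- first-order expansion of `Pt`
  have hPtz : ∀ τ ∈ Icc t₀ s, ‖Pt τ - z‖ ≤ MF * h := by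
    intro τ hτ
    have key := norm_sub_le_of_speed (f := fun _ : ℝ ↦ fieldEuc) (B := closedBall z 1) (L' := MF) hPtd
      hPtb (fun _ _ v hv ↦ hMF v (hball hv)) (t := t₀) (s := τ) (by linarith) hτ.1 (by linarith [hτ.2, (hsI hτ).2])
    rw [hPt0] at key
    calc ‖Pt τ - z‖ ≤ MF * (τ - t₀) := key
      _ ≤ MF * h := by gcongr; rw [hh]; linarith [hτ.2]
  have hPtTaylor : ‖Pt s - z - h • fieldEuc z‖ ≤ ((Lip : ℝ) * (MF * h)) * h := by
    have hmodF : ∀ τ ∈ Icc t₀ s, ‖fieldEuc (Pt τ) - fieldEuc z‖ ≤ (Lip : ℝ) * (MF * h) := by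
      intro τ hτ
      have hτI : τ ∈ Icc (t₀ - hF) (t₀ + hF) := Ioo_subset_Icc_self (hsI hτ)
      have h1 := hLip.norm_sub_le (hball (hPtb τ hτI)) (hball (mem_closedBall_self zero_le_one))
      exact h1.trans (by gcongr; exact hPtz τ hτ)
    have := norm_sub_sub_smul_le (f := fun _ : ℝ ↦ fieldEuc) (α := Pt) (tmin := t₀ - hF) (tmax := t₀ + hF)
      (v := fieldEuc z) (η := (Lip : ℝ) * (MF * h)) hPtd (by linarith) hst₀ (Ioo_subset_Icc_self (hsI
        (right_mem_Icc.2 hst₀))).2 hmodF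
    rw [hPt0] at this
    simpa [hh] using this
  -- (m7) comparison of the two curves at time `s`
  have hFdiff : ‖fieldEuc (b t₀) - fieldEuc z‖ ≤ (Lip : ℝ) * (B₀ + h * Λ + h) := by
    have hb₀mem : b t₀ ∈ closedBall (0 : Euc) (Rc + 4) := by
      rw [mem_closedBall, dist_zero_right]; linarith
    have hzmem : z ∈ closedBall (0 : Euc) (Rc + 4) := by
      rw [mem_closedBall, dist_zero_right]; linarith
    exact (hLip.norm_sub_le hb₀mem hzmem).trans (by gcongr)
  have hdecomp : b s - Pt s = (b s - b t₀ - h • db₀) + (q - z) + h • (fieldEuc (b t₀) - fieldEuc z)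
      - (Pt s - z - h • fieldEuc z) := by
    rw [hdb₀eq, hq]; module
  have hmain : ‖b s - Pt s‖ ≤ B₀ * (1 + L₁ * h) := by
    have hn : ‖b s - Pt s‖ ≤ (Φn * ηΨ) * h + (B₀ + h * (ε / 8)) + h * ((Lip : ℝ) * (B₀ + h * Λ + h))
        + ((Lip : ℝ) * (MF * h)) * h := by
      rw [hdecomp]
      refine (norm_sub_le _ _).trans ?_
      refine add_le_add ((norm_add_le _ _).trans (add_le_add ((norm_add_le _ _).trans
        (add_le_add hTaylor hqz)) ?_)) hPtTaylor
      rw [norm_smul, Real.norm_of_nonneg hhpos.le]; gcongr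
    -- absorb the error terms
    have hΦη : Φn * ηΨ ≤ ε / 8 := by
      rw [hηΨ]
      rw [show Φn * (ε / (8 * (Φn + 1))) = (ε / 8) * (Φn / (Φn + 1)) by field_simp]
      have : Φn / (Φn + 1) ≤ 1 := by rw [div_le_one (by positivity)]; linarith
      calc (ε / 8) * (Φn / (Φn + 1)) ≤ (ε / 8) * 1 := by gcongr
        _ = ε / 8 := mul_one _
    have hhC : h * C₁ ≤ ε / 8 := by
      calc h * C₁ ≤ (ε / (8 * C₁)) * C₁ := by gcongr; exact hhδ.trans hδ7
        _ = ε / 8 := by field_simp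
    have hsmall : h * ((Lip : ℝ) * (Λ + 1 + MF)) ≤ ε / 8 := by
      have : (Lip : ℝ) * (Λ + 1 + MF) ≤ C₁ := by rw [hC₁]; linarith
      calc h * ((Lip : ℝ) * (Λ + 1 + MF)) ≤ h * C₁ := by gcongr
        _ ≤ ε / 8 := hhC
    have h38 : 3 * (ε / 8) ≤ B₀ := by linarith only [hB₀ε, hε]
    have e1 : (Φn * ηΨ) * h ≤ (ε / 8) * h := by gcongr
    have e3 : h * (h * ((Lip : ℝ) * (Λ + 1 + MF))) ≤ h * (ε / 8) := by gcongr
    calc ‖b s - Pt s‖ ≤ (Φn * ηΨ) * h + (B₀ + h * (ε / 8)) + h * ((Lip : ℝ) * (B₀ + h * Λ + h))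
          + ((Lip : ℝ) * (MF * h)) * h := hn
      _ = B₀ + (Φn * ηΨ) * h + h * (ε / 8) + h * ((Lip : ℝ) * B₀)
          + h * (h * ((Lip : ℝ) * (Λ + 1 + MF))) := by ring
      _ ≤ B₀ + (ε / 8) * h + h * (ε / 8) + h * ((Lip : ℝ) * B₀) + h * (ε / 8) := by linarith only [e1, e3]
      _ ≤ B₀ * (1 + L₁ * h) := by rw [hL₁]; nlinarith only [h38, hhpos.le]
  -- the barrier at time `s`
  have hBs : B₀ * (1 + L₁ * h) ≤ ε * Real.exp (L₁ * s) := by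
    have h1 : 1 + L₁ * h ≤ Real.exp (L₁ * h) := by
      have := Real.add_one_le_exp (L₁ * h); linarith
    calc B₀ * (1 + L₁ * h) ≤ B₀ * Real.exp (L₁ * h) := by gcongr
      _ = ε * Real.exp (L₁ * s) := by
          rw [hB₀, mul_assoc, ← Real.exp_add]; congr 2; rw [hh]; ring
  refine ⟨?_, ⟨Pt s, hPts⟩⟩
  calc infDist (bvecCLM (rmComp (G s) y W)) (Z' s) = infDist (b s) (Z' s) := by simp only [hb, hWfs]
    _ ≤ dist (b s) (Pt s) := infDist_le_dist_of_mem hPts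
    _ = ‖b s - Pt s‖ := dist_eq_norm _ _
    _ ≤ B₀ * (1 + L₁ * h) := hmain
    _ ≤ ε * Real.exp (L₁ * s) := hBs

end Family

end HamiltonMP

end Literature.Geometry.Riemannian

end
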